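import Summits.HodgeConjecture.HodgeConjecture.Theses.SecondaryPeriods
import Summits.HodgeConjecture.HodgeConjecture.Theorems.SecondaryPeriodsLevelOneConiveauThreefoldsStubLevelOneSpanOfCurve
import Summits.HodgeConjecture.HodgeConjecture.Theorems.SecondaryPeriodsLevelOneConiveauThreefoldsCurveCorrespondencesConverse
import Summits.HodgeConjecture.HodgeConjecture.Theorems.SecondaryPeriodsLevelOneConiveauThreefoldsKnownRegime
import Summits.HodgeConjecture.HodgeConjecture.Theorems.Ring2AbelianAllAndreCorrespondenceFaithful
import Summits.HodgeConjecture.HodgeConjecture.Theorems.Ring2AbelianAllAndreLiebermanFourier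
import Summits.HodgeConjecture.HodgeConjecture.Theorems.Ring2AbelianAllStandardAPencilsKleimanSquare
import Summits.HodgeConjecture.HodgeConjecture.Theorems.Ring2AbelianAllAndreSquareDegrees
import Summits.HodgeConjecture.HodgeConjecture.Theorems.MilnorKExponentialSymbolClassesAlgebraicNashSymbolClassesAlgebraicHigh
import Summits.HodgeConjecture.HodgeConjecture.Theorems.LinearSystemTorelliTranscendentalOrSupportedStubHodgeEffectiveOfAbstract
import Summits.HodgeConjecture.HodgeConjecture.Theorems.Ring2HypothesesDescentMotivatedTraceFormRational
import Summits.HodgeConjecture.HodgeConjecture.Theorems.Ring2HypothesesDescentMotivatedPositivity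
import Literature.Barriers.HodgeConjecture.DecompositionOfTheDiagonal
import Literature.AlgebraicGeometry.Motives.Uniruled
import Summits.HodgeConjecture.HodgeConjecture.Theorems.NoetherLefschetzOneUpSummitGrantedFourfoldsCohomologicallyAlgebraicTransferSymm
import Literature.AlgebraicGeometry.HodgeTheory.AlgebraicClassesCupDivisorHolds
import Literature.AlgebraicGeometry.HodgeTheory.DivisorCupRaisesGeometricConiveau
import Literature.AlgebraicGeometry.HodgeTheory.SupportedHodgeClassDescent
import Literature.AlgebraicGeometry.HodgeTheory.AlgebraicClassesExteriorProduct
import Literature.AlgebraicGeometry.HodgeTheory.AlgebraicClassesHodgeTypeHolds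
import Literature.AlgebraicGeometry.HodgeTheory.DiagonalKunnethComponentCasimir
import Literature.AlgebraicGeometry.HodgeTheory.GysinFormalismHodgeOfGysin
import Literature.AlgebraicGeometry.HodgeTheory.LefschetzOneOneHolds
import Literature.AlgebraicGeometry.HodgeTheory.IsoTransport
import Literature.AlgebraicGeometry.HodgeTheory.RealStructureSingular
import Literature.AlgebraicTopology.SingularHomology.CompactGroupExteriorCohomology

/-!
# `HC⁴(Y × C)` for all curves `C` ⟺ `GHC(H³(Y), level 1)`, pointwise in the smooth projective threefold `Y`
# (Grothendieck 1969 both ways; the Künneth calibration of a codimension-2 class on `Y × C`)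

Cell `hodge-nonav`: landing of the planner sketch `HOME/memos/ROUTE-P1V-Sketch.lean` (seat p1 g23, sha16
9b9f4ec43884ad01, namespace there `HodgeNonAV.P1V`) by the prover seat `hodge-nonav-prover-Bx` (g8) at the request of
planner p1 g35 (STATUS 2026-08-28T04:05:21Z); proof bodies verbatim, namespace/docstrings tree-shaped. Evidence for the
product sector of `SectorComplement` (stmt-HodgeConjecture-19654) and for the SecondaryPeriods crux
`LevelOneConiveauThreefolds` (stmt-HodgeConjecture-10376).
§1 `HC22TimesCurve Y`: the rational `(2,2)`-classes of `Y × C` and of `C × Y` are algebraic for every smooth projective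
curve `C`. §2 `LevelOneConiveauAt Y`: the pointwise form of the crux (`levelOneConiveauThreefolds_iff` is `Iff.rfl`).
§3 `HC22TimesCurve Y → LevelOneConiveauAt Y` (the tree's direction `levelOneConiveauAt_of_hodgeConjectureFor_prod_curve`).
§4 NEW KERNEL — the KÜNNETH CALIBRATION `mem_algebraicClasses_of_corrAction_calibrated`: a class `w ∈ H⁴(Y × C)` whose
action kills `H¹(C)`, sends `1_C` to a divisor class and `H²(C)_ℚ` to codimension-2 algebraic classes IS algebraic
(faithfulness `eq_of_corrAction_eq_allDegrees`, cross formula `exists_crossFunctional`, Kleiman vanishing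
`Ring2.AbelianAll.corrAction_cross_eq_zero_of_ne`; no Künneth projector, no conjecture), whence the CONVERSE
`hc22_prod_curve_of_levelOneConiveauAt` (via the tree's STUB 2 `curveCorrespondenceAlgebraic_of_levelOneConiveauAt`,
Lefschetz `(1,1)`, curve classes). §5 `hc22TimesCurve_iff_levelOneConiveauAt` (**`HC22×C(Y) ⟺ GHC(3,1)(Y)`**),
`levelOneConiveauThreefolds_iff_forall_hc22TimesCurve`, and KNOWN LOCI as hypotheses on `Y` alone (`CH₀(Y)` supported
on a surface; `N¹H³ = H³`; uniruled `Y` modulo the tree's fact `Debarre2001_uniruled_rationalCurve_through_every_point`;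
`H³ = 0`; `H³(Y;ℚ)` simple and not of level one).
HONEST SCOPE. Equivalences, reductions and re-proofs inside the known region; NOTHING here proves the Hodge conjecture or
GHC(3,1) for a new threefold; rung F-H1 is not moved. References: A. Grothendieck, Topology 8 (1969) p. 301; C. Voisin,
*Hodge Theory I* (2002) Lemma 11.41; S. Bloch, V. Srinivas, Amer. J. Math. 105 (1983) Thm. 1; O. Debarre (2001) Rem. 4.2 (4).
-/


set_option linter.dupNamespace false

noncomputable section

open CategoryTheory AlgebraicGeometry MonoidalCategory CartesianMonoidalCategory
open Literature.AlgebraicTopology.SingularHomology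
open Literature.AlgebraicGeometry Literature.AlgebraicGeometry.Motives
open Literature.AlgebraicGeometry.HodgeTheory
open Summit.HodgeConjecture.HodgeConjecture.Theorems
open Summit.HodgeConjecture.HodgeConjecture.Theorems.CohomologicallyAlgebraic
open Summit.HodgeConjecture.HodgeConjecture.Theorems.MilnorKExponentialNash
open Summit.HodgeConjecture.HodgeConjecture.Ring2.AbelianAll
open Literature.Barriers.HodgeConjecture

namespace Summit.HodgeConjecture.HodgeConjecture.Theorems.ThreefoldTimesCurve

variable {X Y C : SchemeOver ℂ}

/-! ## §1 Verbatim re-declaration (g21/g22 Sketches, namespaces there `HodgeNonAV.P1T` / `.P1U`) -/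

/-- verbatim from Sketch_P1U_RED_g22.lean :180 — **RUNG INPUT `HC22×C(X)` (a FOURFOLD statement)**:
the rational `(2,2)`-classes of `X × C` and of `C × X` are algebraic for every smooth projective
curve `C`. -/
def HC22TimesCurve (X : SchemeOver ℂ) : Prop :=
  ∀ ⦃C : SchemeOver ℂ⦄, IsSmoothProjective 1 C →
    (∀ c : complexBetti (X ⊗ C) (2 * 2), IsRationalClass c →
        IsOfHodgeType (3 + 1) (X ⊗ C) (2 * 2) 2 2 c → c ∈ algebraicClasses (X ⊗ C) 2) ∧
      (∀ c : complexBetti (C ⊗ X) (2 * 2), IsRationalClass c →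
        IsOfHodgeType (1 + 3) (C ⊗ X) (2 * 2) 2 2 c → c ∈ algebraicClasses (C ⊗ X) 2)

/-! ## §2 The pointwise crux `GHC(H³(X), level 1)` and the literal join with SecondaryPeriods -/

/-- **`GHC(3,1)` at the threefold `Y`, read in the Hodge model `A`** — the binder body of the
SecondaryPeriods crux `LevelOneConiveauThreefolds` (stmt-HodgeConjecture-10376): every rationally
spanned level-one sub-Hodge structure of `H³(Y(ℂ); ℂ)` lies in `N¹H³(Y)`. -/
def LevelOneConiveauAtModel (Y : SchemeOver ℂ) (A : HodgeModel 3 Y) : Prop :=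
  ∀ (s : Finset (complexBetti Y 3)), (∀ c ∈ s, IsRationalClass c) →
    (Submodule.span ℂ (↑s : Set (complexBetti Y 3))).map (A.pullback 3).hom =
      (⨆ (p : ℕ) (q : ℕ) (_ : p + q = 3),
        (Submodule.span ℂ (↑s : Set (complexBetti Y 3))).map (A.pullback 3).hom ⊓ A.hodgePQ 3 p q) →
    (Submodule.span ℂ (↑s : Set (complexBetti Y 3))).map (A.pullback 3).hom ≤
      (⨆ (p : ℕ) (q : ℕ) (_ : p + q = 3) (_ : 1 ≤ p) (_ : 1 ≤ q), A.hodgePQ 3 p q) →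
    Submodule.span ℂ (↑s : Set (complexBetti Y 3)) ≤ supportedClasses Y 3 1

/-- **`GHC(3,1)` at `Y`** (for every Hodge model; they agree by
`hodgePQ_independent_of_hodgeModel_holds`). -/
def LevelOneConiveauAt (Y : SchemeOver ℂ) : Prop :=
  ∀ A : HodgeModel 3 Y, LevelOneConiveauAtModel Y A

/-- THE JOIN, literally: the SecondaryPeriods crux is the conjunction over smooth projective
threefolds of the pointwise statement. -/
theorem levelOneConiveauThreefolds_iff :
    Summit.HodgeConjecture.HodgeConjecture.Theses.SecondaryPeriods.LevelOneConiveauThreefolds ↔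
      ∀ ⦃Y : SchemeOver ℂ⦄, IsSmoothProjective 3 Y → LevelOneConiveauAt Y :=
  Iff.rfl

/-! ## §3 `HC22×C(X) ⟹ GHC(3,1)(X)` (the tree's direction, Grothendieck's observation pointwise) -/

/-- Only the FIRST conjunct of `HC22×C(X)` (classes on `X ⊗ C`) is used. Tree engine:
`levelOneConiveauAt_of_hodgeConjectureFor_prod_curve` (Riemann's theorem in geometric form
`weightOne_polarizable_eq_range_of_curve_holds` is discharged there). -/
theorem levelOneConiveauAt_of_hc22_prod_curve (hY : IsSmoothProjective 3 Y)
    (h : ∀ ⦃C : SchemeOver ℂ⦄, IsSmoothProjective 1 C → ∀ c : complexBetti (Y ⊗ C) (2 * 2),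
      IsRationalClass c → IsOfHodgeType (3 + 1) (Y ⊗ C) (2 * 2) 2 2 c →
        c ∈ algebraicClasses (Y ⊗ C) 2) :
    LevelOneConiveauAt Y :=
  fun A s hs hsub hlev ↦ levelOneConiveauAt_of_hodgeConjectureFor_prod_curve hY h A s hs hsub hlev

/-- **`HC22×C(Y) ⟹ GHC(3,1)(Y)`** (Grothendieck's observation, pointwise; tree engine). -/
theorem levelOneConiveauAt_of_hc22TimesCurve (hY : IsSmoothProjective 3 Y) (h : HC22TimesCurve Y) :
    LevelOneConiveauAt Y :=
  levelOneConiveauAt_of_hc22_prod_curve hY fun _ hC ↦ (h hC).1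

/-! ## §4 NEW — Künneth calibration by the action on `H•(C)`, and the converse -/

/-- **A divisor class of the curve acts algebraically under an algebraic correspondence**:
for `γ ∈ N²H⁴(Y × C)` and `ω ∈ N¹H²(C)`, `γ_*(ω) = pr_{Y*}(pr_C^* ω ∪ γ) ∈ N²H⁴(Y)` (divisor cup
raises geometric coniveau `cupProduct_mem_algebraicClasses_of_min_le_one`, then the Gysin support
property of the proper projection `complexGysin_mem_algebraicClasses`). -/
theorem corrAction_divisor_mem_algebraicClasses (hY : IsSmoothProjective 3 Y)
    (hC : IsSmoothProjective 1 C) {γ : complexBetti (Y ⊗ C) (2 * 2)}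
    (hγ : γ ∈ algebraicClasses (Y ⊗ C) 2) {ω : complexBetti C (2 * 1)}
    (hω : ω ∈ algebraicClasses C 1) :
    corrAction complexOrientationFamily hY hC (show 2 * 1 + 2 * 2 = 2 * 2 + 2 * 1 from rfl) γ ω ∈
      algebraicClasses Y 2 := by
  have hYC : IsSmoothProjective (3 + 1) (Y ⊗ C) := hY.tensor_holds hC
  have hq : complexBetti.map (snd Y C) (2 * 1) ω ∈ algebraicClasses (Y ⊗ C) 1 :=
    map_mem_algebraicClasses_one hC hYC (snd Y C) hω
  have hcup : cupProduct (two_mul_add_two_mul 1 2) (complexBetti.map (snd Y C) (2 * 1) ω) γ ∈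
      algebraicClasses (Y ⊗ C) (1 + 2) :=
    cupProduct_mem_algebraicClasses_of_min_le_one hYC (Or.inl le_rfl) hq hγ
  rw [corrAction_apply]
  exact complexGysin_mem_algebraicClasses (gysinMap_restrictCompl_eq_zero_of_field ℂ)
    complexOrientationFamily hasPoincareDuality_complexOrientationFamily hYC hY (fst Y C)
    (q := 1 + 2) (p := 2) (by norm_num) _ hcup

/-- **The unit class of the curve acts algebraically under an algebraic correspondence**:
`γ_*(1_C) ∈ N¹H²(Y)` for `γ ∈ N²H⁴(Y × C)` (`corrAction_mem_supportedClasses`, `r = 2`, `s = 1`). -/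
theorem corrAction_one_mem_algebraicClasses (hY : IsSmoothProjective 3 Y)
    (hC : IsSmoothProjective 1 C) {γ : complexBetti (Y ⊗ C) (2 * 2)}
    (hγ : γ ∈ algebraicClasses (Y ⊗ C) 2) :
    corrAction complexOrientationFamily hY hC (show 0 + 2 * 2 = 2 * 1 + 2 * 1 from rfl) γ
      (singularCohomology.one ℂ (ComplexPoints C)) ∈ algebraicClasses Y 1 :=
  corrAction_mem_supportedClasses complexOrientationFamily hY hC _ (r := 2) (s := 1) (by norm_num)
    hγ _

set_option maxHeartbeats 1000000 in
/-- **KÜNNETH CALIBRATION (the new kernel).** Let `Y` be a smooth projective threefold, `C` a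
smooth projective curve and `w ∈ H⁴((Y × C)(ℂ); ℂ)` ANY class whose action `w_* : H¹(C) → H³(Y)`
vanishes, whose action on the unit class `1_C` is a divisor class of `Y`, and whose action on the
rational classes of `H²(C)` are codimension-2 algebraic classes of `Y`. Then `w` is algebraic:
`w = pr_Y^*β' ∪ pr_C^*1 + pr_Y^*δ' ∪ pr_C^*ω₁` with `β' ∈ N²H⁴(Y)`, `δ' ∈ N¹H²(Y)`, `ω₁` a rational
top class, because both sides act identically in every degree (faithfulness
`eq_of_corrAction_eq_allDegrees`, cross formula `exists_crossFunctional`, Kleiman vanishing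
`corrAction_cross_eq_zero_of_ne`). No Künneth projector and no conjecture enters. -/
theorem mem_algebraicClasses_of_corrAction_calibrated (hY : IsSmoothProjective 3 Y)
    (hC : IsSmoothProjective 1 C) (w : complexBetti (Y ⊗ C) (2 * 2))
    (h1 : corrAction complexOrientationFamily hY hC (show 1 + 2 * 2 = 3 + 2 * 1 from rfl) w = 0)
    (h0 : corrAction complexOrientationFamily hY hC (show 0 + 2 * 2 = 2 * 1 + 2 * 1 from rfl) w
      (singularCohomology.one ℂ (ComplexPoints C)) ∈ algebraicClasses Y 1)
    (h2 : ∀ ω : complexBetti C (2 * 1), IsRationalClass ω →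
      corrAction complexOrientationFamily hY hC (show 2 * 1 + 2 * 2 = 2 * 2 + 2 * 1 from rfl) w ω ∈
        algebraicClasses Y 2) :
    w ∈ algebraicClasses (Y ⊗ C) 2 := by
  obtain ⟨τ, hτ0, hτ⟩ := exists_crossFunctional hY hC
  -- a non-zero rational top class of the curve
  obtain ⟨ω₁, hω₁ne, hω₁rat⟩ : ∃ ω₁ : complexBetti C (2 * 1), ω₁ ≠ 0 ∧ IsRationalClass ω₁ :=
    ⟨_, ofRatClass_lineBasis_ne_zero hC, isRationalClass_ofRatClass _⟩
  have hω₁alg : ω₁ ∈ algebraicClasses C 1 := mem_algebraicClasses_top_degree hC rfl ω₁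
  have hτω₁ : τ ω₁ ≠ 0 := fun h ↦ hω₁ne (hτ0 _ h)
  have h1alg : singularCohomology.one ℂ (ComplexPoints C) ∈ algebraicClasses C 0 :=
    hodgeConjectureFor_codim_zero _
  -- the two calibrating classes on `Y`
  obtain ⟨δ, hδ⟩ : ∃ δ : complexBetti Y (2 * 1), δ = corrAction complexOrientationFamily hY hC
      (show 0 + 2 * 2 = 2 * 1 + 2 * 1 from rfl) w (singularCohomology.one ℂ (ComplexPoints C)) :=
    ⟨_, rfl⟩
  obtain ⟨β, hβ⟩ : ∃ β : complexBetti Y (2 * 2), β = corrAction complexOrientationFamily hY hC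
      (show 2 * 1 + 2 * 2 = 2 * 2 + 2 * 1 from rfl) w ω₁ := ⟨_, rfl⟩
  have hδalg : δ ∈ algebraicClasses Y 1 := hδ ▸ h0
  have hβalg : β ∈ algebraicClasses Y 2 := hβ ▸ h2 ω₁ hω₁rat
  -- unit cup lemmas in the degree spellings met below
  have hone_left : ∀ (h : 0 + 2 * 1 = 2 * 1) (x : complexBetti C (2 * 1)),
      cupProduct h (singularCohomology.one ℂ (ComplexPoints C)) x = x :=
    fun h x ↦ one_cupProduct' ℂ h x
  have hone_right : ∀ (h : 2 * 1 + 2 * 0 = 2 * 1) (x : complexBetti C (2 * 1)),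
      cupProduct h x (singularCohomology.one ℂ (ComplexPoints C)) = x :=
    fun h x ↦ cupProduct_one' ℂ h x
  -- `H²(C) = ℂ · ω₁` (τ is injective with values in `ℂ`)
  have hline : ∀ c : complexBetti C (2 * 1), c = (τ c * (τ ω₁)⁻¹) • ω₁ := by
    intro c
    rw [← sub_eq_zero]
    refine hτ0 _ ?_
    rw [map_sub, map_smul, smul_eq_mul, mul_assoc, inv_mul_cancel₀ hτω₁, (mul_one (τ c)), sub_self]
  -- the action of `w` in degrees `0` and `2`
  have key0 : ∀ r : ℂ, corrAction complexOrientationFamily hY hC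
      (show 0 + 2 * 2 = 2 * 1 + 2 * 1 from rfl) w (r • singularCohomology.one ℂ (ComplexPoints C)) =
        r • δ := by
    intro r
    rw [map_smul, hδ]
  have key2 : ∀ c : complexBetti C (2 * 1), corrAction complexOrientationFamily hY hC
      (show 2 * 1 + 2 * 2 = 2 * 2 + 2 * 1 from rfl) w c = (τ c * (τ ω₁)⁻¹) • β := by
    intro c
    conv_lhs => rw [hline c]
    rw [map_smul, hβ]
  have h40 : 2 * 2 + 2 * 0 = 2 * 2 := rfl
  have h22 : 2 * 1 + 2 * 1 = 2 * 2 := rfl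
  -- THE CALIBRATION IDENTITY
  have hW : w =
      cupProduct h40 (complexBetti.map (fst Y C) (2 * 2) ((τ ω₁)⁻¹ • β))
          (complexBetti.map (snd Y C) (2 * 0) (singularCohomology.one ℂ (ComplexPoints C))) +
        cupProduct h22 (complexBetti.map (fst Y C) (2 * 1) ((τ ω₁)⁻¹ • δ))
          (complexBetti.map (snd Y C) (2 * 1) ω₁) := by
    refine eq_of_corrAction_eq_allDegrees complexOrientationFamily hY hC fun a b hab ha hb ↦ ?_
    refine LinearMap.ext fun c ↦ ?_
    rw [map_add, LinearMap.add_apply]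
    obtain rfl | rfl | rfl : a = 0 ∨ a = 1 ∨ a = 2 * 1 := by omega
    · -- degree 0: only the `ω₁`-term acts, `w_*(r • 1) = r • δ`
      obtain rfl : b = 2 * 1 := by omega
      obtain ⟨r, rfl⟩ := eq_smul_one_of_degree_zero hC c
      rw [key0, Ring2.AbelianAll.corrAction_cross_eq_zero_of_ne hY hC h40 hab (by norm_num), zero_add,
        hτ h22 hab (show 0 + 2 * 1 = 2 * 1 from rfl)]
      simp only [map_smul, LinearMap.smul_apply, hone_left, smul_eq_mul, smul_smul, zero_mul,
        pow_zero, one_mul]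
      rw [mul_inv_cancel_right₀ hτω₁]
    · -- degree 1: both sides vanish
      obtain rfl : b = 3 := by omega
      rw [Ring2.AbelianAll.corrAction_cross_eq_zero_of_ne hY hC h40 hab (by norm_num),
        Ring2.AbelianAll.corrAction_cross_eq_zero_of_ne hY hC h22 hab (by norm_num), add_zero, h1,
        LinearMap.zero_apply]
    · -- degree 2: only the `1`-term acts, `w_*(c) = (τ c / τ ω₁) • β`
      obtain rfl : b = 2 * 2 := by omega
      rw [key2, Ring2.AbelianAll.corrAction_cross_eq_zero_of_ne hY hC h22 hab (by norm_num), add_zero,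
        hτ h40 hab (show 2 * 1 + 2 * 0 = 2 * 1 from rfl), hone_right, smul_smul]
      congr 1
      norm_num
  rw [hW]
  refine Submodule.add_mem _ ?_ ?_
  · exact cupProduct_map_fst_map_snd_mem_algebraicClasses hY hC (l := 2) (k := 0)
      (a := (τ ω₁)⁻¹ • β) (b := singularCohomology.one ℂ (ComplexPoints C))
      (Submodule.smul_mem _ _ hβalg) h1alg
  · exact cupProduct_map_fst_map_snd_mem_algebraicClasses hY hC (l := 1) (k := 1)
      (a := (τ ω₁)⁻¹ • δ) (b := ω₁) (Submodule.smul_mem _ _ hδalg) hω₁alg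

/-- **THE CONVERSE `GHC(3,1)(Y) ⟹` rational `(2,2)`-classes of `Y × C` are algebraic.**
Given a rational `(2,2)`-class `z` on `Y ⊗ C`, its action `z_* : H¹(C) → H³(Y)` is a rational
Hodge map of bidegree `(1,1)` (`corrAction_isRationalHodgeMap`), so by `GHC(3,1)(Y)` and the tree's
STUB 2 `curveCorrespondenceAlgebraic_of_levelOneConiveauAt` there is an ALGEBRAIC `γ ∈ N²H⁴(Y × C)`
with `γ_* = z_*` on `H¹(C)`. The difference `w := z − γ` is calibrated: `w_*(1_C) = z_*(1) − γ_*(1)`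
with `z_*(1)` a rational `(1,1)`-class (Lefschetz `(1,1)`) and `γ_*(1) ∈ N¹` (Gysin support);
`w_*(ω) = z_*(ω) − γ_*(ω)` with `z_*(ω)` a rational `(2,2)`-class on the threefold (curve classes are
algebraic, `mem_algebraicClasses_curveClasses`) and `γ_*(ω) ∈ N²` (divisor cup + Gysin). -/
theorem hc22_prod_curve_of_levelOneConiveauAt (hY : IsSmoothProjective 3 Y)
    (hGHC : LevelOneConiveauAt Y) (hC : IsSmoothProjective 1 C) (z : complexBetti (Y ⊗ C) (2 * 2))
    (hz : IsRationalClass z) (hzH : IsOfHodgeType (3 + 1) (Y ⊗ C) (2 * 2) 2 2 z) :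
    z ∈ algebraicClasses (Y ⊗ C) 2 := by
  obtain ⟨A⟩ := (nonempty_hodgeModel_holds (n := 3) (X := Y)).nonempty hY
  obtain ⟨B⟩ := (nonempty_hodgeModel_holds (n := 1) (X := C)).nonempty hC
  have hφ := corrAction_isRationalHodgeMap hY hC A B (show 1 + 2 * 2 = 3 + 2 * 1 from rfl)
    (show 1 + 1 = 2 from rfl) hz hzH
  obtain ⟨γ, hγalg, hγ⟩ := curveCorrespondenceAlgebraic_of_levelOneConiveauAt hY hC A (hGHC A) B
    _ hφ.1 hφ.2 complexOrientationFamily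
  have h1C : IsOfHodgeType 1 C (2 * 0) 0 0 (singularCohomology.one ℂ (ComplexPoints C)) :=
    isOfHodgeType_of_mem_algebraicClasses_of_isSmoothProjective hC 0 (hodgeConjectureFor_codim_zero _)
  have hw : z - γ ∈ algebraicClasses (Y ⊗ C) 2 := by
    refine mem_algebraicClasses_of_corrAction_calibrated hY hC (z - γ) ?_ ?_ ?_
    · rw [map_sub, hγ, sub_self]
    · rw [map_sub, LinearMap.sub_apply]
      refine Submodule.sub_mem _ ?_ (corrAction_one_mem_algebraicClasses hY hC hγalg)
      refine lefschetzOneOne_rational_holds hY _ ?_ ?_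
      · exact isRationalClass_corrAction_complexOrientationFamily hY hC _ hz (isRationalClass_one _)
      · exact corrAction_isOfHodgeType complexOrientationFamily hY hC _ hzH (p := 0) (q := 0)
          (by norm_num) (by norm_num) h1C
    · intro ω hω
      have hωalg : ω ∈ algebraicClasses C 1 := mem_algebraicClasses_top_degree hC rfl ω
      rw [map_sub, LinearMap.sub_apply]
      refine Submodule.sub_mem _ ?_ (corrAction_divisor_mem_algebraicClasses hY hC hγalg hωalg)
      refine mem_algebraicClasses_curveClasses hY (p := 2) (by norm_num) _ ?_ ?_
      · exact isRationalClass_corrAction_complexOrientationFamily hY hC _ hz hω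
      · exact corrAction_isOfHodgeType complexOrientationFamily hY hC _ hzH (p := 1) (q := 1)
          (by norm_num) (by norm_num) (isOfHodgeType_of_mem_algebraicClasses_of_isSmoothProjective hC 1 hωalg)
  rw [← sub_add_cancel z γ]
  exact Submodule.add_mem _ hw hγalg

/-- The second conjunct from the first: transport along the symmetry `C ⊗ Y ≅ Y ⊗ C`
(as in the tree's `hodgeClasses_algebraic_of_iso`, one codimension at a time). -/
theorem hc22_curve_prod_of_prod_curve (hY : IsSmoothProjective 3 Y) (hC : IsSmoothProjective 1 C)
    (h : ∀ c : complexBetti (Y ⊗ C) (2 * 2), IsRationalClass c →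
      IsOfHodgeType (3 + 1) (Y ⊗ C) (2 * 2) 2 2 c → c ∈ algebraicClasses (Y ⊗ C) 2)
    (c' : complexBetti (C ⊗ Y) (2 * 2)) (hc' : IsRationalClass c')
    (hpp : IsOfHodgeType (1 + 3) (C ⊗ Y) (2 * 2) 2 2 c') : c' ∈ algebraicClasses (C ⊗ Y) 2 := by
  have hYC : IsSmoothProjective (1 + 3) (Y ⊗ C) := hY.tensor_holds hC
  have hCY : IsSmoothProjective (1 + 3) (C ⊗ Y) := hC.tensor_holds hY
  have h1 := h (complexBetti.map (β_ C Y).inv (2 * 2) c') (hc'.map _)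
    (hpp.map_of_isSmoothProjective hYC hCY (β_ C Y).inv)
  have h2 := (mem_algebraicClasses_map_iff_of_iso (β_ C Y)).2 h1
  rwa [(β_ C Y).complexBetti_map_hom_map_inv] at h2

/-! ## §5 The equivalence, the join, and the known locus handed to the RED ladder -/

/-- **`GHC(3,1)(X) ⟹ HC22×C(X)`** (new direction). -/
theorem hc22TimesCurve_of_levelOneConiveauAt (hY : IsSmoothProjective 3 Y)
    (h : LevelOneConiveauAt Y) : HC22TimesCurve Y :=
  fun _ hC ↦ ⟨fun z hz hzH ↦ hc22_prod_curve_of_levelOneConiveauAt hY h hC z hz hzH,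
    hc22_curve_prod_of_prod_curve hY hC
      fun z hz hzH ↦ hc22_prod_curve_of_levelOneConiveauAt hY h hC z hz hzH⟩

/-- **ODD MASTER EQUIVALENCE: `HC22×C(X) ⟺ GHC(H³(X), level 1)`** for every smooth projective
threefold `X`. -/
theorem hc22TimesCurve_iff_levelOneConiveauAt (hY : IsSmoothProjective 3 Y) :
    HC22TimesCurve Y ↔ LevelOneConiveauAt Y :=
  ⟨levelOneConiveauAt_of_hc22TimesCurve hY, hc22TimesCurve_of_levelOneConiveauAt hY⟩

/-- **The SecondaryPeriods crux in fourfold language**: `LevelOneConiveauThreefolds` (item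
stmt-HodgeConjecture-10376) is literally "`HC22×C(X)` for every smooth projective threefold `X`". -/
theorem levelOneConiveauThreefolds_iff_forall_hc22TimesCurve :
    Summit.HodgeConjecture.HodgeConjecture.Theses.SecondaryPeriods.LevelOneConiveauThreefolds ↔
      ∀ ⦃Y : SchemeOver ℂ⦄, IsSmoothProjective 3 Y → HC22TimesCurve Y :=
  ⟨fun h _ hY ↦ hc22TimesCurve_of_levelOneConiveauAt hY (h hY),
    fun h _ hY ↦ levelOneConiveauAt_of_hc22TimesCurve hY (h hY)⟩

/-- **KNOWN LOCUS for the odd rung (new)**: a smooth projective threefold whose Chow group of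
zero-cycles is supported on a surface (`CH₀(X)` supported in dimension `≤ 2`; e.g. uniruled
threefolds) satisfies `HC22×C(X)` — by Bloch–Srinivas `N¹H³(X) = H³(X)` (tree:
`supportedClasses_three_one_eq_top_of_hasChowZeroSupportedInDimLE_two`) and the converse above.
The g22 known locus needed `CH₀` of the FOURFOLD `X × C` in dimension `≤ 3`; this one is a
hypothesis on `X` alone. -/
theorem hc22TimesCurve_of_hasChowZeroSupportedInDimLE_two (hY : IsSmoothProjective 3 Y)
    (hCH : HasChowZeroSupportedInDimLE Y 2) : HC22TimesCurve Y :=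
  hc22TimesCurve_of_levelOneConiveauAt hY fun _ _ _ _ _ ↦
    le_supportedClasses_of_hasChowZeroSupportedInDimLE_two hY hCH _

/-- **CONIVEAU-ONE LOCUS (index row GR69-fin, now one line)**: `N¹H³(X) = H³(X)`
(`supportedClasses X 3 1 = ⊤`) gives `HC22×C(X)` outright. -/
theorem hc22TimesCurve_of_supportedClasses_eq_top (hY : IsSmoothProjective 3 Y)
    (hN : supportedClasses Y 3 1 = ⊤) : HC22TimesCurve Y :=
  hc22TimesCurve_of_levelOneConiveauAt hY fun _ _ _ _ _ ↦ by
    rw [hN]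
    exact le_top

/-- **UNIRULED LOCUS as a hypothesis on `X` ALONE** (modulo Debarre 2001 Rem. 4.2 (4) = the tree's
named fact `Debarre2001_uniruled_rationalCurve_through_every_point`, p532039): a uniruled smooth
projective threefold satisfies `HC22×C(X)`, because `CH₀(X)` is supported on a surface (tree:
`Debarre2001_uniruled_rationalCurve_through_every_point.hasChowZeroSupportedInDimLE`). The g22 form
(`HodgeNonAV.P1U.hc22TimesCurve_of_uniruled_products`) needed `X × C` AND `C × X` uniruled for
every curve `C` (no product lemma in the tree); this one does not. -/
theorem hc22TimesCurve_of_isUniruled (hD : Debarre2001_uniruled_rationalCurve_through_every_point)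
    (hY : IsSmoothProjective 3 Y) (hU : IsUniruled Y) : HC22TimesCurve Y :=
  hc22TimesCurve_of_hasChowZeroSupportedInDimLE_two hY (hD.hasChowZeroSupportedInDimLE hY hU)

/-- **VACUOUS LOCUS**: `H³(X(ℂ); ℂ) = 0` (e.g. rigid threefolds are NOT this — `b₃ = 2` there; this
is `b₃ = 0`: Fano threefolds with `h^{1,2} = 0`, `ℙ³`, quadrics, `V₅`, `V₂₂`) gives `HC22×C(X)`. -/
theorem hc22TimesCurve_of_subsingleton_H3 (hY : IsSmoothProjective 3 Y)
    (h3 : Subsingleton (complexBetti Y 3)) : HC22TimesCurve Y :=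
  hc22TimesCurve_of_levelOneConiveauAt hY fun _ s _ _ _ ↦ by
    intro x _
    rw [Subsingleton.elim x 0]
    exact Submodule.zero_mem _

/-- **EMPTY-SLOT LOCUS (typed form of lit §60 (L3), Mboro arXiv:1708.02422 Lemma 4.3 for very general
complete-intersection threefolds): if `H³(X(ℂ); ℚ)` is SIMPLE as a rational Hodge structure (every
rationally spanned sub-Hodge structure is `0` or everything) and `h^{3,0}(X) ≠ 0` (`H³` is not of
Hodge level one), then `GHC(3,1)(X)` holds vacuously, hence `HC22×C(X)`.** The print input making the
hypothesis hold for the very general quintic / complete-intersection threefold is big monodromy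
(Beauville 1986) + `MT ⊇` a finite-index subgroup of monodromy (a PRINT fact, not typed here). -/
theorem hc22TimesCurve_of_H3_simple (hY : IsSmoothProjective 3 Y)
    (hsimple : ∀ (A : HodgeModel 3 Y) (s : Finset (complexBetti Y 3)), (∀ c ∈ s, IsRationalClass c) →
      (Submodule.span ℂ (↑s : Set (complexBetti Y 3))).map (A.pullback 3).hom =
        (⨆ (p : ℕ) (q : ℕ) (_ : p + q = 3),
          (Submodule.span ℂ (↑s : Set (complexBetti Y 3))).map (A.pullback 3).hom ⊓
            A.hodgePQ 3 p q) →
      Submodule.span ℂ (↑s : Set (complexBetti Y 3)) = ⊥ ∨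
        Submodule.span ℂ (↑s : Set (complexBetti Y 3)) = ⊤)
    (h30 : ∀ A : HodgeModel 3 Y, ¬ (⊤ : Submodule ℂ (complexBetti Y 3)).map (A.pullback 3).hom ≤
      ⨆ (p : ℕ) (q : ℕ) (_ : p + q = 3) (_ : 1 ≤ p) (_ : 1 ≤ q), A.hodgePQ 3 p q) :
    HC22TimesCurve Y := by
  refine hc22TimesCurve_of_levelOneConiveauAt hY fun A s hs hsub hlev ↦ ?_
  rcases hsimple A s hs hsub with h | h
  · rw [h]
    exact bot_le
  · exact absurd (h ▸ hlev) (h30 A)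

end Summit.HodgeConjecture.HodgeConjecture.Theorems.ThreefoldTimesCurve

end
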